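import Summits.BirchSwinnertonDyer.BirchSwinnertonDyer.Theorems.EisensteinPrimesFullDescentNoUnramifiedCharacter
import Literature.NumberTheory.EllipticCurves.OpenImageMazurCharacterProofs
import Summits.BirchSwinnertonDyer.Rank1Residual.X2.TateLineDecomposition
import HarnessLib

/-!
# Route `EisensteinPrimes`, crux 2 `GoodLatticeBDPValue` (stmt-BirchSwinnertonDyer-19032), line `halves` v21, stub 3a-B
# `stub_fullDescentAtThreeOfRed`, brick F6 (Lemma S′): **the isogeny character of a rational `N`-line is a power of the
# mod `N` cyclotomic character as soon as it is unramified at the bad primes `≠ N`** — at `N = 3`: the line is the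
# `𝟙`-line or the `ω`-line

Cell `bsd-eis` (home `run/shared/lean/pub/bsd-eis/`), width seat `bsd-line-x1-p1-w2` (gen 5; `--supports -19032`, closes
nothing by itself). Brick F6 of the AN-3 road memo `HOME/line-x1-p1-w3-g4/AN3-StubB-elementary-road.md` (Lemma S′, §2 L1):
for `E/ℚ` good at `3` with no additive prime and a rational line `Φ ≤ E[3]`, the character of `Φ` is `𝟙` or `ω = χ̄₃`. The
tree's Mazur 1978 §5 file (`OpenImageMazurCharacterProofs`) already carries the global engine: Lemma 5.2 over `ℚ`
(`Mazur1978.exists_eq_modNCyclotomicCharacter_pow_of_mem_inertia`: `r = χ̄_N^k` on the inertia groups at `N`) and the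
normal form `r = b·χ̄_N^k`, `bⁿ = 1` (`…exists_forall_eq_mul_modNCyclotomicCharacter_pow`). Here:

* `exists_eq_modNCyclotomicCharacter_pow_of_exists_inertia` — the case `n = 1` in the ONE-PRIME-PER-PLACE currency: a
  character `r : Γ_ℚ →* (ℤ/N)ˣ` with open kernel that kills SOME inertia group above every `v ∤ N` is `χ̄_N^k` (Lemma 5.2
  + this seat's `FullDescentNoUnramifiedCharacter.monoidHom_eq_one_of_forall_exists_inertia`, i.e. Kronecker–Weber +
  «ℚ has no unramified abelian extension»);
* `smul_eq_of_unipotent_of_card_eq` — a UNIPOTENT element (`τ` trivial on a line `X ≤ E[N]` and on `E[N]/X`) fixes every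
  `τ`-stable line pointwise (two lines of prime order meet trivially or coincide, `TateLineDecomposition.inf_eq_bot_or_eq`)
  — this is how the Tate curve at a multiplicative `ℓ ≠ N` (inertia unipotent: `C[N] = μ_N` fixed, `E[N]/C[N]` trivial;
  bricks F2 of w3 gen 4) feeds the previous item;
* **`exists_lineCharacter_eq_pow`** — for `E/ℚ`, a rational `N`-line `⟨P⟩` with character `r`, GOOD or UNIPOTENT-INERTIA
  reduction at every `v ∤ N` (the local input, one prime `𝔓 ∣ v` per place): `r = χ̄_N^k`;
* `lineCharacter_three_dichotomy` — `N = 3`: `r = 𝟙` or `r = χ̄₃` (`(ℤ/3)ˣ` has exponent `2`), i.e. `Γ_ℚ` fixes `P`, or acts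
  on it through `χ̄₃`.

HONEST FRAMING: helper theorems only (0 definitions, 0 named facts, 0 sorry); the local unipotence at the multiplicative
primes is a HYPOTHESIS here (bricks F2); no summit statement, no BSD / IMC2 / Keller–Yin theorem, no stub of the
registered skeleton is proved. References: [Mazur1978] §5 Lemma 5.2–5.3, Prop. 5.1 (pp. 149–152); [Serre1972] §1.12, §5.4;
[Kriz2016] Thm. 34 (1) (proof: «one of `χ₁, χ₂` is unramified outside the squarefull part of `N`»).
-/

set_option autoImplicit false
-- the route's Theorems namespace repeats the summit name by design (D-0017 nested layout)
set_option linter.dupNamespace false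

noncomputable section

open scoped Classical NumberField

namespace Summit.BirchSwinnertonDyer.BirchSwinnertonDyer.Theorems.FullDescentLemmaS

open Function NumberField IsDedekindDomain Field Rat.HeightOneSpectrum WeierstrassCurve
  Literature.NumberTheory.GaloisRepresentations Literature.NumberTheory.EllipticCurves
  Summit.BirchSwinnertonDyer.BirchSwinnertonDyer.Theorems.FullDescentNoUnramifiedCharacter

/-! ## §1. Mazur's normal form with exponent one, one prime per place -/

/-- **A character `Γ_ℚ → (ℤ/N)ˣ` (open kernel) that kills some inertia group above every place `v ∤ N` is a power of
the mod `N` cyclotomic character.** Mazur 1978 Lemma 5.2 over `ℚ` (tree: `r = χ̄_N^k` on the inertia groups at `N`)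
makes `α = r·χ̄_N^{−k}` kill an inertia group above EVERY place (`χ̄_N` is unramified away from `N`), hence `α = 1`
(`monoidHom_eq_one_of_forall_exists_inertia`). [cite: Mazur1978, §5 Lemma 5.2–5.3, Prop. 5.1 (pp. 149–152)] -/
theorem exists_eq_modNCyclotomicCharacter_pow_of_exists_inertia (N : ℕ) [Fact N.Prime]
    (r : absoluteGaloisGroup ℚ →* (ZMod N)ˣ)
    (hker : IsOpen ((r.ker : Subgroup (absoluteGaloisGroup ℚ)) : Set (absoluteGaloisGroup ℚ)))
    (hloc : ∀ v : HeightOneSpectrum (𝓞 ℚ), (N : 𝓞 ℚ) ∉ v.asIdeal →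
      ∃ 𝔓 ∈ v.primesAbove, ∀ τ ∈ 𝔓.inertia (absoluteGaloisGroup ℚ), r τ = 1) :
    ∃ k : ℕ, ∀ σ : absoluteGaloisGroup ℚ, r σ = modNCyclotomicCharacter ℚ N σ ^ k := by
  have hN : N.Prime := Fact.out
  haveI : NeZero N := ⟨hN.ne_zero⟩
  obtain ⟨k, hk⟩ := Mazur1978.exists_eq_modNCyclotomicCharacter_pow_of_mem_inertia N r hker
  refine ⟨k, ?_⟩
  set χ : absoluteGaloisGroup ℚ →* (ZMod N)ˣ := modNCyclotomicCharacter ℚ N with hχdef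
  -- `α = r χ⁻ᵏ`
  let α : absoluteGaloisGroup ℚ →* (ZMod N)ˣ :=
    { toFun := fun σ ↦ r σ * (χ σ ^ k)⁻¹
      map_one' := by rw [map_one, map_one, one_pow, inv_one, mul_one]
      map_mul' := fun σ τ ↦ by rw [map_mul, map_mul, mul_pow, mul_inv, mul_mul_mul_comm] }
  have hα : ∀ σ, α σ = r σ * (χ σ ^ k)⁻¹ := fun σ ↦ rfl
  have hαker : IsOpen ((α.ker : Subgroup (absoluteGaloisGroup ℚ)) : Set (absoluteGaloisGroup ℚ)) := by
    refine Subgroup.isOpen_mono (H₁ := r.ker ⊓ χ.ker) ?_ ?_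
    · intro σ hσ
      rw [Subgroup.mem_inf, MonoidHom.mem_ker, MonoidHom.mem_ker] at hσ
      rw [MonoidHom.mem_ker, hα, hσ.1, hσ.2, one_pow, inv_one, one_mul]
    · rw [Subgroup.coe_inf]
      exact hker.inter (Mazur1978.isOpen_ker_modNCyclotomicCharacter N)
  have hαI : ∀ v : HeightOneSpectrum (𝓞 ℚ), ∃ 𝔓 ∈ v.primesAbove,
      ∀ τ ∈ 𝔓.inertia (absoluteGaloisGroup ℚ), α τ = 1 := by
    intro v
    by_cases hv : (N : 𝓞 ℚ) ∈ v.asIdeal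
    · refine ⟨adicCompletionPrime ℚ v, adicCompletionPrime_mem_primesAbove ℚ v, fun τ hτ ↦ ?_⟩
      rw [hα, hk v hv _ (adicCompletionPrime_mem_primesAbove ℚ v) τ hτ, mul_inv_cancel]
    · obtain ⟨𝔓, h𝔓, hI⟩ := hloc v hv
      refine ⟨𝔓, h𝔓, fun τ hτ ↦ ?_⟩
      haveI := h𝔓.1
      have hχ1 : χ τ = 1 :=
        modNCyclotomicCharacter_eq_one_of_mem_inertia (Mazur1978.natCast_not_mem_of_not_mem_asIdeal hv h𝔓) hτ
      rw [hα, hI τ hτ, hχ1, one_pow, inv_one, mul_one]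
  have hα1 : α = 1 := monoidHom_eq_one_of_forall_exists_inertia α hαker hαI
  intro σ
  have h1 := DFunLike.congr_fun hα1 σ
  rw [MonoidHom.one_apply, hα, mul_inv_eq_one] at h1
  exact h1

/-! ## §2. A unipotent element fixes every stable line pointwise -/

/-- **Unipotent ⟹ trivial on each stable line.** In `E[N]` (`N` prime, any field), let `τ` fix a line `X` (order `N`)
pointwise and act trivially on `E[N]/X` (`τ Q − Q ∈ X`); then `τ` fixes pointwise every `τ`-stable subgroup `Φ` of
order `N`: either `Φ = X`, or `Φ ⊓ X = ⊥` and `τ P − P ∈ Φ ⊓ X`. This is how the inertia group at a multiplicative prime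
`ℓ ≠ N` (Tate: `τ ζ_N = ζ_N`, `τ q^{1/N} ≡ q^{1/N} mod μ_N`) is seen to act trivially on a rational `N`-line.
[cite: Serre1972, §1.12 (`ρ̄|I ⊆ (1 *; 0 1)` at a multiplicative prime `ℓ ≠ p`)] -/
theorem smul_eq_of_unipotent_of_card_eq (W : WeierstrassCurve ℚ) [W.IsElliptic] (N : ℕ)
    [Fact N.Prime] {τ : absoluteGaloisGroup ℚ} {X Φ : AddSubgroup (geomTorsion W (N : ℤ))}
    (hX : Nat.card X = N) (hfixX : ∀ x ∈ X, τ • x = x) (hquot : ∀ Q : geomTorsion W (N : ℤ), τ • Q - Q ∈ X)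
    (hΦ : Nat.card Φ = N) (hΦτ : ∀ P ∈ Φ, τ • P ∈ Φ) : ∀ P ∈ Φ, τ • P = P := by
  intro P hP
  rcases Rank1Residual.X2.TateLineDecomposition.inf_eq_bot_or_eq W N hΦ hX with h | h
  · -- `Φ ⊓ X = ⊥`: `τ P - P ∈ Φ ⊓ X`
    have hmem : τ • P - P ∈ Φ ⊓ X := ⟨Φ.sub_mem (hΦτ P hP) hP, hquot P⟩
    rw [h, AddSubgroup.mem_bot, sub_eq_zero] at hmem
    exact hmem
  · -- `Φ = X`
    exact hfixX P (h ▸ hP)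

/-! ## §3. The isogeny character of a rational line unramified at the bad primes is a cyclotomic power -/

/-- **Lemma S′, general prime `N`: the character of a rational `N`-line on `E/ℚ` is `χ̄_N^k` when at every place `v ∤ N`
the curve has good reduction or SOME inertia group above `v` acts unipotently on `E[N]`** (trivially on a line `X` of
order `N` and on `E[N]/X` — the Tate shape at a multiplicative prime `ℓ ≠ N`). At the good places the character is
unramified by Néron–Ogg–Shafarevich (`Mazur1978.isogenyCharacter_eq_one_of_mem_inertia`), at the others by §2; then §1.
[cite: Mazur1978, §5 Lemma 5.2–5.3, Prop. 5.1 (pp. 149–152)] [cite: Serre1972, §1.12] -/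
theorem exists_lineCharacter_eq_pow (W : WeierstrassCurve ℚ) [W.IsElliptic] (N : ℕ) [Fact N.Prime]
    {P : geomTorsion W (N : ℤ)} (hP0 : P ≠ 0) {r : absoluteGaloisGroup ℚ →* (ZMod N)ˣ}
    (hr : ∀ σ : absoluteGaloisGroup ℚ, σ • P = ((r σ : (ZMod N)ˣ) : ZMod N).val • P)
    (hloc : ∀ v : HeightOneSpectrum (𝓞 ℚ), (N : 𝓞 ℚ) ∉ v.asIdeal → W.HasGoodReductionAt v ∨
      ∃ 𝔓 ∈ v.primesAbove, ∃ X : AddSubgroup (geomTorsion W (N : ℤ)), Nat.card X = N ∧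
        ∀ τ ∈ 𝔓.inertia (absoluteGaloisGroup ℚ),
          (∀ x ∈ X, τ • x = x) ∧ (∀ Q : geomTorsion W (N : ℤ), τ • Q - Q ∈ X)) :
    ∃ k : ℕ, ∀ σ : absoluteGaloisGroup ℚ, r σ = modNCyclotomicCharacter ℚ N σ ^ k := by
  have hN : N.Prime := Fact.out
  haveI : NeZero N := ⟨hN.ne_zero⟩
  -- the line `Φ = ⟨P⟩` has order `N` and is `Γ_ℚ`-stable
  set Φ : AddSubgroup (geomTorsion W (N : ℤ)) := AddSubgroup.zmultiples P with hΦdef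
  have hPord : addOrderOf P = N := by
    have hNP : (N : ℤ) • P = 0 := by
      apply Subtype.ext
      have h := (mem_torsionPoints_iff _ _ (P : geomPoints W)).mp P.2
      rwa [natCast_zsmul] at h ⊢
    have hdvd : addOrderOf P ∣ N := by
      apply addOrderOf_dvd_of_nsmul_eq_zero
      rwa [natCast_zsmul] at hNP
    rcases (Nat.dvd_prime hN).mp hdvd with h1 | h1
    · exact absurd (AddMonoid.addOrderOf_eq_one_iff.mp h1) hP0
    · exact h1
  have hΦcard : Nat.card Φ = N := by rw [hΦdef, Nat.card_zmultiples, hPord]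
  have hΦst : ∀ σ : absoluteGaloisGroup ℚ, ∀ Q ∈ Φ, σ • Q ∈ Φ := by
    intro σ Q hQ
    obtain ⟨k, rfl⟩ := AddSubgroup.mem_zmultiples_iff.mp hQ
    have h1 : σ • (k • P) = k • (σ • P) := map_zsmul (DistribSMul.toAddMonoidHom _ σ) k P
    rw [h1, hr σ]
    exact Φ.zsmul_mem (Φ.nsmul_mem (AddSubgroup.mem_zmultiples P) _) _
  refine exists_eq_modNCyclotomicCharacter_pow_of_exists_inertia N r (Mazur1978.isOpen_ker_of_smul_eq W N hP0 hr)
    fun v hv ↦ ?_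
  rcases hloc v hv with hgood | ⟨𝔓, h𝔓, X, hX, hτX⟩
  · exact ⟨adicCompletionPrime ℚ v, adicCompletionPrime_mem_primesAbove ℚ v, fun τ hτ ↦
      Mazur1978.isogenyCharacter_eq_one_of_mem_inertia W N hP0 hr hgood hv (adicCompletionPrime_mem_primesAbove ℚ v) hτ⟩
  · refine ⟨𝔓, h𝔓, fun τ hτ ↦ ?_⟩
    have hfix : τ • P = P :=
      smul_eq_of_unipotent_of_card_eq W N hX (hτX τ hτ).1 (hτX τ hτ).2 hΦcard (hΦst τ) P
        (AddSubgroup.mem_zmultiples P)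
    -- `r τ = 1` from `(r τ).val • P = P`, `P ≠ 0` of prime order
    rw [hr τ] at hfix
    have hmod : ((((r τ : (ZMod N)ˣ) : ZMod N).val : ℤ) - 1) • P = 0 := by
      rw [sub_smul, one_smul, natCast_zsmul, hfix, sub_self]
    have hdvd : (addOrderOf P : ℤ) ∣ (((r τ : (ZMod N)ˣ) : ZMod N).val : ℤ) - 1 :=
      addOrderOf_dvd_iff_zsmul_eq_zero.mpr hmod
    rw [hPord] at hdvd
    ext
    rw [Units.val_one]
    have h1 : (((((r τ : (ZMod N)ˣ) : ZMod N).val : ℤ) : ZMod N)) = ((1 : ℤ) : ZMod N) :=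
      (ZMod.intCast_eq_intCast_iff_dvd_sub _ _ N).mpr (by simpa using dvd_sub_comm.mp hdvd)
    rw [Int.cast_natCast, ZMod.natCast_zmod_val, Int.cast_one] at h1
    exact h1

/-! ## §4. `N = 3`: the line is the `𝟙`-line or the `ω`-line -/

/-- **Lemma S′ at `3`: a rational `3`-line of a curve good-or-unipotent away from `3` is the `𝟙`-line or the
`ω`-line** — its character is `𝟙` (every `σ ∈ Γ_ℚ` fixes `P`) or `χ̄₃` (`σ P = χ̄₃(σ) P`): `(ℤ/3)ˣ` has exponent `2`.
[cite: Mazur1978, §5 Lemma 5.2–5.3 (pp. 149–151)] [cite: Kriz2016, Thm. 34 (1)] -/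
theorem lineCharacter_three_dichotomy (W : WeierstrassCurve ℚ) [W.IsElliptic]
    {P : geomTorsion W ((3 : ℕ) : ℤ)} (hP0 : P ≠ 0) {r : absoluteGaloisGroup ℚ →* (ZMod 3)ˣ}
    (hr : ∀ σ : absoluteGaloisGroup ℚ, σ • P = ((r σ : (ZMod 3)ˣ) : ZMod 3).val • P)
    (hloc : ∀ v : HeightOneSpectrum (𝓞 ℚ), ((3 : ℕ) : 𝓞 ℚ) ∉ v.asIdeal → W.HasGoodReductionAt v ∨
      ∃ 𝔓 ∈ v.primesAbove, ∃ X : AddSubgroup (geomTorsion W ((3 : ℕ) : ℤ)), Nat.card X = 3 ∧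
        ∀ τ ∈ 𝔓.inertia (absoluteGaloisGroup ℚ),
          (∀ x ∈ X, τ • x = x) ∧ (∀ Q : geomTorsion W ((3 : ℕ) : ℤ), τ • Q - Q ∈ X)) :
    (∀ σ : absoluteGaloisGroup ℚ, r σ = 1) ∨
      (∀ σ : absoluteGaloisGroup ℚ, r σ = modNCyclotomicCharacter ℚ 3 σ) := by
  haveI : Fact (Nat.Prime 3) := ⟨Nat.prime_three⟩
  obtain ⟨k, hk⟩ := exists_lineCharacter_eq_pow W 3 hP0 hr hloc
  have hsq : ∀ u : (ZMod 3)ˣ, u ^ 2 = 1 := fun u ↦ by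
    have h := ZMod.pow_totient u
    rwa [Nat.totient_prime Nat.prime_three] at h
  have hpow : ∀ u : (ZMod 3)ˣ, u ^ k = u ^ (k % 2) := fun u ↦ by
    conv_lhs => rw [← Nat.div_add_mod k 2, pow_add, pow_mul, hsq, one_pow, one_mul]
  rcases Nat.mod_two_eq_zero_or_one k with h0 | h1
  · left
    intro σ
    rw [hk σ, hpow, h0, pow_zero]
  · right
    intro σ
    rw [hk σ, hpow, h1, pow_one]

end Summit.BirchSwinnertonDyer.BirchSwinnertonDyer.Theorems.FullDescentLemmaS

end
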